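import Summits.RiemannHypothesis.RiemannHypothesis.Theorems.RuelleBandExactFirstBandGaussExplicit
import Summits.RiemannHypothesis.RiemannHypothesis.Theorems.RuelleBandExactFirstBandStubHeatBounded
import Literature.NumberTheory.LFunctions.KadiriFarZeroTail
import Literature.NumberTheory.LFunctions.RiemannHypothesisUpTo101
import HarnessLib

/-!
# The rank-one face of the Gaussian-cone bet is unconditional: `Z(u) > 0` and `Re W(g_u) > 0`

Line `Sketch` (heat cone) for the crux `Summit.RiemannHypothesis.RiemannHypothesis.Theses.RuelleBand.ExactFirstBand`
(item stmt-RiemannHypothesis-2061), supporting theorems (lead c3).  The line's only open stub,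
`stub_weilGaussPD` ("`u ↦ Re W(g_u)` is positive definite on `((0,∞),+)`", Weil positivity on the Gaussian
cone), is kernel-checked equivalent to `RiemannHypothesis` (`weilGaussPD_iff_riemannHypothesis`).  This file
proves that its RANK-ONE case holds UNCONDITIONALLY:

* `heatTrace_re_pos` — the zero heat trace is positive: `0 < Re Σ_ρ m(ρ) e^{-uρ(1-ρ)}` for every `u > 0`;
* `weilGauss_re_pos` — equivalently (Gaussian explicit formula `heatTrace_eq_gauss`, `Z(u) = e^{-u/4} W(g_u)`)
  `0 < Re W(g_u)` for every centred Gaussian `g_u(t) = (4πu)^{-1/2} e^{-t²/(4u)}`: Weil's functional is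
  positive at each single Gaussian `g_u = g_{u/2} ⋆ g̃_{u/2}`, with no hypothesis;
* `stub_weilGaussPD_rank_one` — the registered stub `stub_weilGaussPD` at `n = 1`, verbatim.

So the RH content of the Gaussian-cone criterion lives entirely in the MIXED terms (rank `≥ 2`, the
moment problem `n → ∞`).  Proof (tightness remark of `Cruxes/ExactFirstBand/Lines/Sketch-dead.md` §4,
made effective with the tree's KERNEL-ONLY certified numerics, standard axioms): the zeros with
`|Im ρ| ≤ 101` lie on the critical line (`riemannHypothesisInStripUpTo_hundredOne`, `decide +kernel`
certificate) and contribute `m(ρ) e^{-u(1/4+γ²)} > 0`; one of them has `0 < γ ≤ 33` (the first bracket group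
`RH101.checkZeros₁` of that certificate: five zeros on the line below `8443/2⁸`) and contributes at least
`e^{-u c₀}`, `c₀ = 1/4 + 33²`; a zero with `|γ| > 101` can contribute a negative real part only when
`u|γ||1 - 2β| > π/2`, hence `u|γ| > 3/2`, and then its modulus is at most
`m(ρ) e^{-uγ²} ≤ m(ρ) e^{-uc₀} e^{-(4/3)|γ|} ≤ e^{-uc₀} · 10⁻³ · m(ρ)/γ²` (`c₀ ≤ 0.11 γ²`); finally
`Σ_{|γ| ≥ 101} m(ρ)/γ² ≤ 3 B(0, 101) ≤ 102` by the tree's explicit far-zero tail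
(`KadiriTail.summable_far_and_tsum_le`, from the explicit Riemann–von Mangoldt bounds), so
`Re Z(u) ≥ e^{-uc₀}(1 - 0.102) > 0`.

References: A. Weil (1952); E. Bombieri, Rend. Lincei (9) 11 (2000) §2; H. Kadiri, Acta Arith. 117 (2005)
Lemma 4.3 (far-zero tail); R. P. Brent, Math. Comp. 33 (1979) §3 (RH to height 101, recomputed in tree, kernel-only).
-/

set_option linter.dupNamespace false

noncomputable section

open Complex MeasureTheory Filter Set
open scoped BigOperators Topology ComplexConjugate Real

namespace Summit.RiemannHypothesis.RiemannHypothesis.Theorems.RuelleBandExactFirstBand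

open Summit.RiemannHypothesis.RiemannHypothesis.Theses.RuelleBand
open Literature.NumberTheory.LFunctions

/-- Elementary: for `x ≥ 101`, `e^{-(4/3)x} ≤ 10⁻³/x²` (from `y⁴/4! ≤ e^y`). [folklore] -/
theorem rankOne_exp_le {x : ℝ} (hx : 101 ≤ x) : Real.exp (-(4 / 3 * x)) ≤ 1 / (1000 * x ^ 2) := by
  have hx0 : 0 < x := by linarith
  have h := Real.pow_div_factorial_le_exp (x := 4 / 3 * x) (by positivity) 4
  have h24 : ((Nat.factorial 4 : ℕ) : ℝ) = 24 := by norm_num [Nat.factorial]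
  rw [h24] at h
  rw [Real.exp_neg, inv_eq_one_div, div_le_div_iff₀ (Real.exp_pos _) (by positivity), one_mul, one_mul]
  have hx2 : (101 : ℝ) ^ 2 ≤ x ^ 2 := pow_le_pow_left₀ (by norm_num) hx 2
  have h1 : 1000 * x ^ 2 ≤ (4 / 3 * x) ^ 4 / 24 := by
    have : 0 ≤ x ^ 2 * (32 * x ^ 2 - 243000) := mul_nonneg (sq_nonneg x) (by nlinarith)
    nlinarith [this]
  exact h1.trans h

/-- Crude numerics for the far-zero tail constant: `B(0, 101) ≤ 34` (`B = KadiriTail.tailBound`;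
`log y ≤ y - 1`). [folklore] -/
theorem rankOne_tailBound_le : KadiriTail.tailBound 0 101 ≤ 34 := by
  unfold KadiriTail.tailBound
  have h7 : Real.log (0 + 7) ≤ 6 := by
    have := Real.log_le_sub_one_of_pos (show (0 : ℝ) < 0 + 7 by norm_num); linarith
  have h101 : Real.log 101 ≤ 100 := by
    have := Real.log_le_sub_one_of_pos (show (0 : ℝ) < 101 by norm_num); linarith
  have h0 : 0 ≤ Real.log 101 := Real.log_nonneg (by norm_num)
  have hA : (154 + 30 * Real.log (0 + 7)) * (1 / (101 : ℝ) ^ 2 + 1 / 101) ≤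
      334 * (1 / (101 : ℝ) ^ 2 + 1 / 101) :=
    mul_le_mul_of_nonneg_right (by linarith) (by positivity)
  have hB : Real.log 101 / (101 : ℝ) ^ 2 + (Real.log 101 + 1) / 101 ≤
      100 / (101 : ℝ) ^ 2 + (100 + 1) / 101 := by
    gcongr
  have hC : 334 * (1 / (101 : ℝ) ^ 2 + 1 / 101) ≤ 3.4 := by norm_num
  have hD : 100 / (101 : ℝ) ^ 2 + (100 + 1) / 101 ≤ 1.01 := by norm_num
  linarith

/-- **The far-zero tail, explicit**: `Σ'_{|Im ρ| ≥ 101} m(ρ)/(Im ρ)² ≤ 102` over the non-trivial zeros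
(summable), from `KadiriTail.summable_far_and_tsum_le` at centre `0`, `t₀ = 101`. [cite: Kadiri2005, Lemma 4.3] -/
theorem rankOne_far_tsum_le :
    Summable (fun ρ : ZetaZeros.riemannZetaNontrivialZeros =>
      if (101 : ℝ) ≤ |(ρ : ℂ).im| then (riemannZetaZeroOrder (ρ : ℂ) : ℝ) / (ρ : ℂ).im ^ 2 else 0) ∧
    ∑' ρ : ZetaZeros.riemannZetaNontrivialZeros,
      (if (101 : ℝ) ≤ |(ρ : ℂ).im| then (riemannZetaZeroOrder (ρ : ℂ) : ℝ) / (ρ : ℂ).im ^ 2 else 0) ≤ 102 := by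
  have h := KadiriTail.summable_far_and_tsum_le (t := 0) (t₀ := 101) le_rfl (by norm_num)
  simp only [sub_zero] at h
  refine ⟨h.1, h.2.trans ?_⟩
  linarith [rankOne_tailBound_le]

/-- `ζ` has a zero on the critical line with `0 < Im ρ ≤ 33` (the first bracket group of the kernel-checked
certificate `RH101.checkZeros₁`: five zeros on the line below `8443/2⁸ = 32.98…`). [cite: Brent1979, §3] -/
theorem rankOne_exists_low_zero :
    ∃ z : ℂ, riemannZeta z = 0 ∧ z.re = 1 / 2 ∧ 0 < z.im ∧ z.im ≤ 33 := by
  have h := RHUpToCert.criticalZeroCount_of_checkZeros RH101.checkZeros₁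
  simp only [RHUpToCert.lastB, List.length_cons, List.length_nil] at h
  have hpos : criticalZeroCount (((8443 : ℕ) : ℝ) / 256) ≠ 0 := by omega
  by_contra hne
  push Not at hne
  apply hpos
  have hempty : {ρ ∈ zetaZeroBox (1 / 2) (((8443 : ℕ) : ℝ) / 256) | ρ.re = 1 / 2} = ∅ := by
    ext ρ
    simp only [Set.mem_setOf_eq, Set.mem_empty_iff_false, iff_false, not_and, zetaZeroBox]
    intro hρ hre
    exact absurd (hρ.2.2.2.2.trans (by norm_num)) (not_le.2 (hne ρ hρ.1 hre hρ.2.2.2.1))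
  unfold criticalZeroCount
  rw [hempty, finsum_mem_empty]
  rfl

/-- Real and imaginary parts of the heat exponent `λ_ρ = ρ(1-ρ)`: `Re λ = β(1-β) + γ²`, `Im λ = γ(1-2β)`.
[folklore] -/
theorem rankOne_lambda_re_im (z : ℂ) :
    (z * (1 - z)).re = z.re * (1 - z.re) + z.im ^ 2 ∧ (z * (1 - z)).im = z.im * (1 - 2 * z.re) := by
  constructor
  · simp only [mul_re, sub_re, one_re, sub_im, one_im]; ring
  · simp only [mul_im, sub_re, one_re, sub_im, one_im]; ring

/-- The real part of one term of the heat trace: `Re(m e^{-uλ}) = m e^{-u Re λ} cos(u Im λ)`. [folklore] -/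
theorem rankOne_term_re (u : ℝ) (m : ℤ) (w : ℂ) :
    ((m : ℂ) * cexp (-((u : ℂ) * w))).re = (m : ℝ) * (Real.exp (-(u * w.re)) * Real.cos (u * w.im)) := by
  rw [← Complex.ofReal_intCast, Complex.re_ofReal_mul, Complex.exp_re, neg_re, neg_im, re_ofReal_mul,
    im_ofReal_mul, Real.cos_neg]

/-- The exponent bookkeeping for a far zero: if `|γ| ≥ 101`, `u|γ| > 3/2` and `c₀ = 1/4 + 33²`, then
`u(γ² - c₀) ≥ (4/3)|γ|` (`c₀ ≤ (11/100)γ²`, `(89/100)(3/2) ≥ 4/3`). [folklore] -/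
theorem rankOne_key {u g c₀ : ℝ} (hu : 0 < u) (hc₀ : c₀ = 1 / 4 + 33 ^ 2) (hg : 101 ≤ |g|)
    (hug : 3 / 2 < u * |g|) : 4 / 3 * |g| ≤ u * (g ^ 2 - c₀) := by
  have ha : 0 ≤ |g| := abs_nonneg g
  have hsq : g ^ 2 = |g| ^ 2 := (sq_abs g).symm
  have hbig : (101 : ℝ) ^ 2 ≤ |g| ^ 2 := pow_le_pow_left₀ (by norm_num) hg 2
  have h1 : c₀ ≤ 11 / 100 * |g| ^ 2 := by rw [hc₀]; norm_num at hbig ⊢; linarith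
  have h2 : 89 / 100 * |g| ^ 2 ≤ g ^ 2 - c₀ := by rw [hsq]; linarith
  have h3 : u * (89 / 100 * |g| ^ 2) ≤ u * (g ^ 2 - c₀) := mul_le_mul_of_nonneg_left h2 hu.le
  have h4 : 3 / 2 * |g| ≤ u * |g| * |g| := mul_le_mul_of_nonneg_right hug.le ha
  have h5 : u * (89 / 100 * |g| ^ 2) = 89 / 100 * (u * |g| * |g|) := by ring
  rw [h5] at h3
  linarith

/-- **The zero heat trace is positive (unconditionally).** For every `u > 0`,
`0 < Re Z(u) = Re Σ_ρ m(ρ) e^{-uρ(1-ρ)}` over the non-trivial zeros of `ζ` — the rank-one case of the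
heat-cone / Gaussian-cone bet of line `Sketch`, proved from RH up to height `101` (kernel-only certificate,
with its first bracket group locating a zero below height `33`) and the explicit far-zero tail; see the module
docstring. [cite: Kadiri2005, Lemma 4.3] -/
theorem heatTrace_re_pos (u : ℝ) (hu : 0 < u) :
    0 < (∑' ρ : ZetaZeros.riemannZetaNontrivialZeros,
      (riemannZetaZeroOrder (ρ : ℂ) : ℂ) * cexp (-((u : ℂ) * ((ρ : ℂ) * (1 - (ρ : ℂ)))))).re := by
  classical
  set F : ZetaZeros.riemannZetaNontrivialZeros → ℂ := fun ρ =>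
    (riemannZetaZeroOrder (ρ : ℂ) : ℂ) * cexp (-((u : ℂ) * ((ρ : ℂ) * (1 - (ρ : ℂ))))) with hF
  have hsumF : Summable F := (stub_heatBounded_summable_norm hu).of_norm
  have hsumRe : Summable fun ρ => (F ρ).re := (Complex.hasSum_re hsumF.hasSum).summable
  rw [Complex.re_tsum hsumF]
  -- the witness: an on-line zero of height `≤ 33`
  obtain ⟨z₁, hz1, -, him0, him1⟩ := rankOne_exists_low_zero
  have hmem₁ : z₁ ∈ ZetaZeros.riemannZetaNontrivialZeros :=
    ZetaZeros.riemannZetaNontrivialZeros.mem_of_im_ne_zero hz1 him0.ne'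
  set ρ₁ : ZetaZeros.riemannZetaNontrivialZeros := ⟨z₁, hmem₁⟩ with hρ₁
  set c₀ : ℝ := 1 / 4 + 33 ^ 2 with hc₀
  -- the comparison functions
  set gpos : ZetaZeros.riemannZetaNontrivialZeros → ℝ := fun ρ =>
    if ρ = ρ₁ then Real.exp (-(u * c₀)) else 0 with hgpos
  set gneg : ZetaZeros.riemannZetaNontrivialZeros → ℝ := fun ρ =>
    Real.exp (-(u * c₀)) * (1 / 1000) *
      (if (101 : ℝ) ≤ |(ρ : ℂ).im| then (riemannZetaZeroOrder (ρ : ℂ) : ℝ) / (ρ : ℂ).im ^ 2 else 0)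
    with hgneg
  have hgpos_sum : HasSum gpos (Real.exp (-(u * c₀))) := hasSum_ite_eq ρ₁ _
  obtain ⟨hfar_sum, hfar_le⟩ := rankOne_far_tsum_le
  have hgneg_sum : Summable gneg := hfar_sum.mul_left _
  have hE : 0 < Real.exp (-(u * c₀)) := Real.exp_pos _
  have hgneg_le : ∑' ρ, gneg ρ ≤ Real.exp (-(u * c₀)) * (1 / 1000) * 102 := by
    rw [hgneg, tsum_mul_left]
    exact mul_le_mul_of_nonneg_left hfar_le (by positivity)
  -- the pointwise comparison `gpos - gneg ≤ Re F`
  have hpt : ∀ ρ : ZetaZeros.riemannZetaNontrivialZeros, gpos ρ - gneg ρ ≤ (F ρ).re := by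
    intro ρ
    have hρ := ρ.2
    have hβ0 := ZetaZeros.riemannZetaNontrivialZeros.re_pos hρ
    have hβ1 := ZetaZeros.riemannZetaNontrivialZeros.re_lt_one hρ
    have hm1 : (1 : ℝ) ≤ riemannZetaZeroOrder (ρ : ℂ) := by
      exact_mod_cast ZetaZeros.riemannZetaNontrivialZeros.one_le_order hρ
    obtain ⟨hre, him⟩ := rankOne_lambda_re_im (ρ : ℂ)
    have hFre : (F ρ).re = (riemannZetaZeroOrder (ρ : ℂ) : ℝ) *
        (Real.exp (-(u * ((ρ : ℂ) * (1 - (ρ : ℂ))).re)) * Real.cos (u * ((ρ : ℂ) * (1 - (ρ : ℂ))).im)) :=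
      rankOne_term_re u _ _
    -- the far indicator term is nonnegative
    have hind : 0 ≤ (if (101 : ℝ) ≤ |(ρ : ℂ).im| then (riemannZetaZeroOrder (ρ : ℂ) : ℝ) / (ρ : ℂ).im ^ 2
        else 0) := by
      split_ifs
      · positivity
      · exact le_rfl
    have hgneg0 : 0 ≤ gneg ρ := by rw [hgneg]; positivity
    by_cases hnear : |(ρ : ℂ).im| ≤ 101
    · -- near zeros are on the line: the term is `m e^{-u(1/4+γ²)} ≥ 0`, and `≥ e^{-uc₀}` at `ρ₁`
      have hhalf : (ρ : ℂ).re = 1 / 2 :=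
        riemannHypothesisInStripUpTo_hundredOne _ (ZetaZeros.riemannZetaNontrivialZeros.zeta_eq_zero hρ) hβ0 hβ1
          hnear
      have hre' : ((ρ : ℂ) * (1 - (ρ : ℂ))).re = 1 / 4 + (ρ : ℂ).im ^ 2 := by rw [hre, hhalf]; ring
      have him' : ((ρ : ℂ) * (1 - (ρ : ℂ))).im = 0 := by rw [him, hhalf]; ring
      rw [hFre, hre', him', mul_zero, Real.cos_zero, mul_one]
      have hterm0 : 0 ≤ (riemannZetaZeroOrder (ρ : ℂ) : ℝ) * Real.exp (-(u * (1 / 4 + (ρ : ℂ).im ^ 2))) := by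
        positivity
      by_cases h1 : ρ = ρ₁
      · have hgp : gpos ρ = Real.exp (-(u * c₀)) := by rw [hgpos]; exact if_pos h1
        have himρ : (ρ : ℂ).im = z₁.im := by rw [h1]
        have hexp : Real.exp (-(u * c₀)) ≤ Real.exp (-(u * (1 / 4 + (ρ : ℂ).im ^ 2))) := by
          rw [Real.exp_le_exp, himρ, hc₀]
          have h33 : z₁.im ^ 2 ≤ 33 ^ 2 := pow_le_pow_left₀ him0.le him1 2
          exact neg_le_neg (mul_le_mul_of_nonneg_left (by linarith) hu.le)
        have hm : Real.exp (-(u * (1 / 4 + (ρ : ℂ).im ^ 2))) ≤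
            (riemannZetaZeroOrder (ρ : ℂ) : ℝ) * Real.exp (-(u * (1 / 4 + (ρ : ℂ).im ^ 2))) :=
          le_mul_of_one_le_left (Real.exp_pos _).le hm1
        calc gpos ρ - gneg ρ ≤ gpos ρ := sub_le_self _ hgneg0
          _ = Real.exp (-(u * c₀)) := hgp
          _ ≤ _ := hexp
          _ ≤ _ := hm
      · have hgp : gpos ρ = 0 := by rw [hgpos]; exact if_neg h1
        linarith
    · -- far zeros: either the cosine is nonnegative, or `u|γ| > 3/2` and the modulus is tiny
      push Not at hnear
      have h1 : ρ ≠ ρ₁ := by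
        intro h
        have : (ρ : ℂ).im = z₁.im := by rw [h]
        rw [this, abs_of_pos him0] at hnear
        linarith
      have hgp : gpos ρ = 0 := by rw [hgpos]; exact if_neg h1
      have hgn : gneg ρ = Real.exp (-(u * c₀)) * (1 / 1000) *
          ((riemannZetaZeroOrder (ρ : ℂ) : ℝ) / (ρ : ℂ).im ^ 2) := by
        rw [hgneg]; simp only [if_pos hnear.le]
      rw [hgp, zero_sub, hFre]
      set γ : ℝ := (ρ : ℂ).im with hγ
      set β : ℝ := (ρ : ℂ).re with hβ
      have hE1 : 0 < Real.exp (-(u * ((ρ : ℂ) * (1 - (ρ : ℂ))).re)) := Real.exp_pos _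
      by_cases hcos : |u * ((ρ : ℂ) * (1 - (ρ : ℂ))).im| ≤ π / 2
      · -- nonnegative term
        have hc : 0 ≤ Real.cos (u * ((ρ : ℂ) * (1 - (ρ : ℂ))).im) :=
          Real.cos_nonneg_of_neg_pi_div_two_le_of_le (abs_le.1 hcos).1 (abs_le.1 hcos).2
        have hm0 : (0 : ℝ) ≤ riemannZetaZeroOrder (ρ : ℂ) := by linarith
        have : 0 ≤ (riemannZetaZeroOrder (ρ : ℂ) : ℝ) *
            (Real.exp (-(u * ((ρ : ℂ) * (1 - (ρ : ℂ))).re)) * Real.cos (u * ((ρ : ℂ) * (1 - (ρ : ℂ))).im)) :=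
          mul_nonneg hm0 (mul_nonneg hE1.le hc)
        linarith
      · push Not at hcos
        -- `u|γ| > π/2 > 3/2`
        have huγ : 3 / 2 < u * |γ| := by
          rw [him] at hcos
          have hb : |1 - 2 * β| ≤ 1 := abs_le.2 ⟨by rw [hβ]; linarith, by rw [hβ]; linarith⟩
          have e : |u * (γ * (1 - 2 * β))| = u * |γ| * |1 - 2 * β| := by
            rw [abs_mul, abs_mul, abs_of_pos hu, mul_assoc]
          rw [e] at hcos
          have h2 : u * |γ| * |1 - 2 * β| ≤ u * |γ| := mul_le_of_le_one_right (by positivity) hb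
          linarith [Real.pi_gt_three]
        -- lower bound on the term by minus its modulus, modulus by `m e^{-uγ²}`
        have hcos1 : -1 ≤ Real.cos (u * ((ρ : ℂ) * (1 - (ρ : ℂ))).im) := Real.neg_one_le_cos _
        have hRel : γ ^ 2 ≤ ((ρ : ℂ) * (1 - (ρ : ℂ))).re := stub_heatSummable_sq_im_le_re hβ0 hβ1
        have hexp1 : Real.exp (-(u * ((ρ : ℂ) * (1 - (ρ : ℂ))).re)) ≤ Real.exp (-(u * γ ^ 2)) := by
          rw [Real.exp_le_exp]; exact neg_le_neg (mul_le_mul_of_nonneg_left hRel hu.le)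
        -- `e^{-uγ²} = e^{-uc₀} e^{-u(γ²-c₀)}` and `u(γ² - c₀) ≥ (4/3)|γ|`
        have hkey : 4 / 3 * |γ| ≤ u * (γ ^ 2 - c₀) := rankOne_key hu hc₀ hnear.le huγ
        have hexp2 : Real.exp (-(u * γ ^ 2)) ≤ Real.exp (-(u * c₀)) * (1 / (1000 * |γ| ^ 2)) := by
          have e : Real.exp (-(u * γ ^ 2)) = Real.exp (-(u * c₀)) * Real.exp (-(u * (γ ^ 2 - c₀))) := by
            rw [← Real.exp_add]; ring_nf
          rw [e]
          refine mul_le_mul_of_nonneg_left ?_ hE.le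
          calc Real.exp (-(u * (γ ^ 2 - c₀))) ≤ Real.exp (-(4 / 3 * |γ|)) := by
                rw [Real.exp_le_exp]; exact neg_le_neg hkey
            _ ≤ 1 / (1000 * |γ| ^ 2) := rankOne_exp_le hnear.le
        rw [sq_abs] at hexp2
        have hm0 : (0 : ℝ) ≤ riemannZetaZeroOrder (ρ : ℂ) := by linarith
        -- assemble: `-gneg ≤ -m e^{-uγ²} ≤ m e^{-u Re λ} cos(…)`
        have hA : -(riemannZetaZeroOrder (ρ : ℂ) : ℝ) * Real.exp (-(u * ((ρ : ℂ) * (1 - (ρ : ℂ))).re)) ≤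
            (riemannZetaZeroOrder (ρ : ℂ) : ℝ) *
              (Real.exp (-(u * ((ρ : ℂ) * (1 - (ρ : ℂ))).re)) * Real.cos (u * ((ρ : ℂ) * (1 - (ρ : ℂ))).im)) := by
          have h := mul_le_mul_of_nonneg_left hcos1 (mul_nonneg hm0 hE1.le)
          have e1 : -(riemannZetaZeroOrder (ρ : ℂ) : ℝ) * Real.exp (-(u * ((ρ : ℂ) * (1 - (ρ : ℂ))).re)) =
              (riemannZetaZeroOrder (ρ : ℂ) : ℝ) * Real.exp (-(u * ((ρ : ℂ) * (1 - (ρ : ℂ))).re)) * (-1) := by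
            ring
          rw [e1, ← mul_assoc]
          exact h
        have hB : (riemannZetaZeroOrder (ρ : ℂ) : ℝ) * Real.exp (-(u * ((ρ : ℂ) * (1 - (ρ : ℂ))).re)) ≤
            gneg ρ := by
          rw [hgn]
          calc (riemannZetaZeroOrder (ρ : ℂ) : ℝ) * Real.exp (-(u * ((ρ : ℂ) * (1 - (ρ : ℂ))).re))
              ≤ (riemannZetaZeroOrder (ρ : ℂ) : ℝ) * (Real.exp (-(u * c₀)) * (1 / (1000 * γ ^ 2))) :=
                mul_le_mul_of_nonneg_left (hexp1.trans hexp2) hm0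
            _ = Real.exp (-(u * c₀)) * (1 / 1000) * ((riemannZetaZeroOrder (ρ : ℂ) : ℝ) / γ ^ 2) := by
                have hγ0 : γ ≠ 0 := by
                  intro h0; rw [h0, abs_zero] at hnear; linarith
                field_simp
        linarith
  -- conclusion
  have hle : ∑' ρ, (gpos ρ - gneg ρ) ≤ ∑' ρ, (F ρ).re :=
    Summable.tsum_le_tsum hpt (hgpos_sum.summable.sub hgneg_sum) hsumRe
  have h1 : ∑' ρ, (gpos ρ - gneg ρ) = Real.exp (-(u * c₀)) - ∑' ρ, gneg ρ := by
    rw [hgpos_sum.summable.tsum_sub hgneg_sum, hgpos_sum.tsum_eq]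
  calc (0 : ℝ) < Real.exp (-(u * c₀)) - Real.exp (-(u * c₀)) * (1 / 1000) * 102 := by
        rw [show Real.exp (-(u * c₀)) - Real.exp (-(u * c₀)) * (1 / 1000) * 102 =
          Real.exp (-(u * c₀)) * (898 / 1000) by ring]
        positivity
    _ ≤ Real.exp (-(u * c₀)) - ∑' ρ, gneg ρ := by linarith [hgneg_le]
    _ = ∑' ρ, (gpos ρ - gneg ρ) := h1.symm
    _ ≤ ∑' ρ, (F ρ).re := hle

/-- **Weil's functional is positive at every centred Gaussian (unconditionally).** For `u > 0` and
`g_u(t) = (4πu)^{-1/2} e^{-t²/(4u)}`, `0 < Re W(g_u)` (`W = weilFunctional`): by the Gaussian explicit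
formula `Z(u) = e^{-u/4} W(g_u)` (`heatTrace_eq_gauss`) and `heatTrace_re_pos`. This is the rank-one case
of `stub_weilGaussPD`; the full stub is `⟺ RiemannHypothesis` (`weilGaussPD_iff_riemannHypothesis`).
[cite: Bombieri2000Weil, §2 Thm 2] -/
theorem weilGauss_re_pos (u : ℝ) (hu : 0 < u) :
    0 < (weilFunctional
      (fun t : ℝ => ((Real.exp (-(t ^ 2) / (4 * u)) / Real.sqrt (4 * Real.pi * u) : ℝ) : ℂ))).re := by
  have h := heatTrace_re_pos u hu
  rw [heatTrace_eq_gauss u hu, show -(u : ℂ) / 4 = ((-(u / 4) : ℝ) : ℂ) by push_cast; ring,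
    ← Complex.ofReal_exp, Complex.re_ofReal_mul] at h
  exact (mul_pos_iff_of_pos_left (Real.exp_pos _)).1 h

/-- **The registered stub `stub_weilGaussPD` at rank one** (`n = 1`, verbatim instance): for `s₀ > 0` and
real `c₀`, `0 ≤ c₀² Re W(g_{2s₀})`. Unconditional, by `weilGauss_re_pos`. [folklore] -/
theorem stub_weilGaussPD_rank_one :
    ∀ (s c : Fin 1 → ℝ), (∀ a, 0 < s a) →
      0 ≤ ∑ a, ∑ b, c a * c b *
        (weilFunctional (fun t : ℝ =>
          ((Real.exp (-(t ^ 2) / (4 * (s a + s b))) / Real.sqrt (4 * Real.pi * (s a + s b)) : ℝ) : ℂ))).re := by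
  intro s c hs
  simp only [Fin.sum_univ_one]
  have h := weilGauss_re_pos (s 0 + s 0) (add_pos (hs 0) (hs 0))
  have hc : 0 ≤ c 0 * c 0 := mul_self_nonneg _
  exact mul_nonneg hc h.le

end Summit.RiemannHypothesis.RiemannHypothesis.Theorems.RuelleBandExactFirstBand

end
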